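import Literature.MathematicalPhysics.KineticTheory.HardSphereEulerProofs
import Summits.AtomisticToContinuum.HydrodynamicLimit.Theorems.InformationPercolationEngineChaosClosesEulerEntropyBalanceA
import Summits.AtomisticToContinuum.HydrodynamicLimit.Theorems.InformationPercolationEnginePercolationClosesChaosCesaroKdeStability
import HarnessLib

/-!
# Windowed entropy balance — helper B: the Gaussian velocity mollifier

Helper file for the registered stub `stub_windowedEntropyBalance` of the line `empirical-h-theorem`
(crux `InformationPercolationEngine.ChaosClosesEuler`, stmt-AtomisticToContinuum-15141).

WHAT. The velocity coarse-graining kernel `φ_δ(v) = M_{1,δ²,0}(v) = (2πδ²)^{-3/2} e^{-|v|²/(2δ²)}`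
(`phi`): positivity, the sup bound `φ_δ ≤ φ_δ(0)`, evenness, unit mass of every translate, and the
two transfer facts that carry all velocity integrals of the windowed entropy balance:
`∫ φ_δ(v − a) F(v) dv = ∫ F(a + δw) dN(0, id)(w)` (`integral_phi_sub_mul`) and integrability of
`φ_δ(· − a) F` for every measurable `F` dominated by the envelope `C (1 + |v|²)²`
(`integrable_phi_sub_mul`, through `M_{1,δ²,a} dv = gaussMeasure a δ²` and Fernique). Consequences
(with `E|w| ≤ 2`, the landed `EquilibriumForecastLine.integral_norm_stdGaussian_le_two`):
the quartic bound `∫ φ_δ(v − a)(1 + |v|²)² dv ≤ c₄(δ)(1 + |a|⁴)` with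
`c₄(δ) = 18 + 16 δ⁴ E|w|⁴` (`integral_phi_env_le`) and the linear bound for the entropic weight
`∫ φ_δ(v − a) A(v) dv ≤ |K| + |log M| + 2 + 4|a| + 8δ` (`integral_phi_Aw_le`).

References: folklore (Gaussian moments); X. Fernique (1970) via Mathlib's `IsGaussian.memLp_id`.
-/

noncomputable section

namespace Summit.AtomisticToContinuum.HydrodynamicLimit.Theorems.ChaosClosesEulerEntropyBalance

open scoped BigOperators Topology Classical MeasureTheory ENNReal InnerProductSpace
open Filter Set MeasureTheory ProbabilityTheory
open Literature.MathematicalPhysics.KineticTheory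
open Literature.Analysis.FluidPDE

/-! ## §1 The kernel `φ_δ` -/

/-- The velocity mollifier `φ_δ(v) = M_{1, δ², 0}(v)` (a centred Gaussian of variance `δ²`). [folklore] -/
def phi (δ : ℝ) (v : V3) : ℝ := localMaxwellian 1 (δ ^ 2) 0 v

/-- Its maximum `φ_δ(0) = (2πδ²)^{-3/2}`. [folklore] -/
def phiMax (δ : ℝ) : ℝ := phi δ 0

/-- `φ_δ > 0`. [folklore] -/
theorem phi_pos {δ : ℝ} (hδ : 0 < δ) (v : V3) : 0 < phi δ v :=
  localMaxwellian_pos one_pos (pow_pos hδ 2) 0 v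

/-- `φ_δ ≥ 0`. [folklore] -/
theorem phi_nonneg {δ : ℝ} (hδ : 0 < δ) (v : V3) : 0 ≤ phi δ v := (phi_pos hδ v).le

/-- `φ_δ(0) > 0`. [folklore] -/
theorem phiMax_pos {δ : ℝ} (hδ : 0 < δ) : 0 < phiMax δ := phi_pos hδ 0

/-- `φ_δ ≤ φ_δ(0)`. [folklore] -/
theorem phi_le_phiMax (δ : ℝ) (v : V3) : phi δ v ≤ phiMax δ := by
  unfold phiMax phi localMaxwellian
  refine mul_le_mul_of_nonneg_left (Real.exp_le_exp.2 ?_) ?_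
  · rw [sub_zero, sub_zero, norm_zero, neg_div, neg_div]
    simp only [ne_eq, OfNat.ofNat_ne_zero, not_false_eq_true, zero_pow, zero_div, neg_zero, Left.neg_nonpos_iff]
    positivity
  · exact mul_nonneg zero_le_one (Real.rpow_nonneg (by positivity) _)

/-- `φ_δ` is even. [folklore] -/
theorem phi_neg (δ : ℝ) (v : V3) : phi δ (-v) = phi δ v := by
  simp [phi, localMaxwellian, norm_neg]

/-- `φ_δ(a − b) = φ_δ(b − a)`. [folklore] -/
theorem phi_sub_comm (δ : ℝ) (a b : V3) : phi δ (a - b) = phi δ (b - a) := by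
  rw [← neg_sub, phi_neg]

/-- A translate of `φ_δ` is the local Maxwellian with that bulk velocity. [folklore] -/
theorem phi_sub_eq (δ : ℝ) (a v : V3) : phi δ (v - a) = localMaxwellian 1 (δ ^ 2) a v := by
  simp [phi, localMaxwellian, sub_zero]

/-- `φ_δ` is continuous. [folklore] -/
theorem continuous_phi (δ : ℝ) : Continuous (phi δ) := continuous_localMaxwellian 1 _ 0

/-- `φ_δ` is measurable. [folklore] -/
theorem measurable_phi (δ : ℝ) : Measurable (phi δ) := (continuous_phi δ).measurable

/-! ## §2 Transfer to the standard Gaussian -/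

/-- **Transfer identity**: `∫ φ_δ(v − a) F(v) dv = ∫ F(a + δ w) dN(0, id)(w)`. [folklore] -/
theorem integral_phi_sub_mul {δ : ℝ} (hδ : 0 < δ) (F : V3 → ℝ) (a : V3) :
    ∫ v, phi δ (v - a) * F v = ∫ w, F (a + δ • w) ∂stdGaussian V3 := by
  have h := integral_localMaxwellian_smul (E := V3) (pow_pos hδ 2) a F
  rw [Real.sqrt_sq hδ.le] at h
  rw [← h]
  refine integral_congr_ae (Eventually.of_forall fun v => ?_)
  simp only [smul_eq_mul, phi_sub_eq]

/-- Every translate of `φ_δ` has unit mass. [folklore] -/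
theorem integral_phi_sub {δ : ℝ} (hδ : 0 < δ) (a : V3) : ∫ v, phi δ (v - a) = 1 := by
  have h := integral_phi_sub_mul hδ (fun _ => (1 : ℝ)) a
  simpa using h

/-- **Integrability transfer**: `φ_δ(· − a) F` is integrable for every measurable `F` dominated
by `C (1 + |v|²)²` (all moments of a Gaussian measure are finite). [folklore] -/
theorem integrable_phi_sub_mul {δ : ℝ} (hδ : 0 < δ) {F : V3 → ℝ} (hF : Measurable F) {C : ℝ}
    (hle : ∀ v, |F v| ≤ C * (1 + ‖v‖ ^ 2) ^ 2) (a : V3) :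
    Integrable (fun v => phi δ (v - a) * F v) := by
  have hθ : 0 < δ ^ 2 := pow_pos hδ 2
  have hm : Measurable fun v : V3 => ENNReal.ofReal (localMaxwellian 1 (δ ^ 2) a v) :=
    (continuous_localMaxwellian 1 _ a).measurable.ennreal_ofReal
  have h1 : Integrable F (gaussMeasure a (δ ^ 2)) := by
    have h2 : Integrable (fun v : V3 => ‖v‖ ^ 2) (gaussMeasure a (δ ^ 2)) :=
      (IsGaussian.memLp_id _ 2 (by simp)).integrable_norm_pow (by norm_num)
    have h4 : Integrable (fun v : V3 => ‖v‖ ^ 4) (gaussMeasure a (δ ^ 2)) :=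
      (IsGaussian.memLp_id _ 4 (by simp)).integrable_norm_pow (by norm_num)
    have hg : Integrable (fun v : V3 => C * (1 + ‖v‖ ^ 2) ^ 2) (gaussMeasure a (δ ^ 2)) := by
      have heq : (fun v : V3 => C * (1 + ‖v‖ ^ 2) ^ 2) = fun v => C * (1 + 2 * ‖v‖ ^ 2 + ‖v‖ ^ 4) := by
        funext v; ring
      rw [heq]
      exact (((integrable_const 1).add (h2.const_mul 2)).add h4).const_mul C
    refine hg.mono' hF.aestronglyMeasurable (Eventually.of_forall fun v => ?_)
    rw [Real.norm_eq_abs]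
    exact hle v
  rw [← withDensity_localMaxwellian_eq_gaussMeasure hθ a,
    integrable_withDensity_iff_integrable_smul' hm (Eventually.of_forall fun _ => ENNReal.ofReal_lt_top)] at h1
  refine h1.congr (Eventually.of_forall fun v => ?_)
  simp only [smul_eq_mul]
  rw [ENNReal.toReal_ofReal (localMaxwellian_nonneg zero_le_one hθ.le a v), phi_sub_eq]

/-- A translate of `φ_δ` is integrable. [folklore] -/
theorem integrable_phi_sub {δ : ℝ} (hδ : 0 < δ) (a : V3) : Integrable (fun v => phi δ (v - a)) := by
  have h := integrable_phi_sub_mul hδ (F := fun _ => (1 : ℝ)) measurable_const (C := 1)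
    (fun v => by rw [abs_one, one_mul]; nlinarith [norm_nonneg v]) a
  simpa using h

/-! ## §3 The envelope `(1 + |v|²)²` and the two moment bounds -/

/-- `1 ≤ (1 + |v|²)²`. [folklore] -/
theorem one_le_env (v : V3) : 1 ≤ (1 + ‖v‖ ^ 2) ^ 2 := by nlinarith [norm_nonneg v]

/-- `|v| ≤ (1 + |v|²)²`. [folklore] -/
theorem norm_le_env (v : V3) : ‖v‖ ≤ (1 + ‖v‖ ^ 2) ^ 2 := by
  nlinarith [norm_nonneg v, sq_nonneg (‖v‖ - 1)]

/-- `|v|² ≤ (1 + |v|²)²`. [folklore] -/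
theorem norm_sq_le_env (v : V3) : ‖v‖ ^ 2 ≤ (1 + ‖v‖ ^ 2) ^ 2 := by nlinarith [norm_nonneg v]

/-- The entropic weight is dominated by the envelope: `A(v) ≤ (|K| + |log M| + 6)(1 + |v|²)²`.
[folklore] -/
theorem Aw_le_env (K M : ℝ) (v : V3) : Aw K M v ≤ (|K| + |Real.log M| + 6) * (1 + ‖v‖ ^ 2) ^ 2 := by
  have h1 := Aw_le K M v
  have h2 := norm_le_env v
  have h3 := one_le_env v
  have h4 : 0 ≤ |K| + |Real.log M| + 2 := by positivity
  nlinarith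

/-- The fourth absolute moment `E|w|⁴` of the standard Gaussian on `ℝ³` (finite by Fernique; its
value `15` is not needed). [folklore] -/
def M4g : ℝ := ∫ w, ‖w‖ ^ 4 ∂stdGaussian V3

/-- `E|w|⁴ ≥ 0`. [folklore] -/
theorem M4g_nonneg : 0 ≤ M4g := integral_nonneg fun _ => by positivity

/-- The quartic constant `c₄(δ) = 18 + 16 δ⁴ E|w|⁴`. [folklore] -/
def c4 (δ : ℝ) : ℝ := 18 + 16 * δ ^ 4 * M4g

/-- `c₄(δ) ≥ 18 > 0`. [folklore] -/
theorem c4_pos (δ : ℝ) : 0 < c4 δ := by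
  have h := M4g_nonneg; unfold c4; positivity

/-- Pointwise: `(1 + |a + δw|²)² ≤ 2 + 16|a|⁴ + 16 δ⁴|w|⁴` (`δ ≥ 0`). [folklore] -/
theorem env_add_smul_le {δ : ℝ} (hδ : 0 ≤ δ) (a w : V3) :
    (1 + ‖a + δ • w‖ ^ 2) ^ 2 ≤ 2 + 16 * ‖a‖ ^ 4 + 16 * δ ^ 4 * ‖w‖ ^ 4 := by
  have h1 : ‖a + δ • w‖ ≤ ‖a‖ + δ * ‖w‖ := by
    calc ‖a + δ • w‖ ≤ ‖a‖ + ‖δ • w‖ := norm_add_le _ _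
      _ = ‖a‖ + δ * ‖w‖ := by rw [norm_smul, Real.norm_eq_abs, abs_of_nonneg hδ]
  set p := ‖a‖
  set q := δ * ‖w‖
  have hp : 0 ≤ p := norm_nonneg a
  have hq : 0 ≤ q := mul_nonneg hδ (norm_nonneg w)
  have hx : 0 ≤ ‖a + δ • w‖ := norm_nonneg _
  have h2 : ‖a + δ • w‖ ^ 2 ≤ (p + q) ^ 2 := pow_le_pow_left₀ hx h1 2
  have h3 : (p + q) ^ 2 ≤ 2 * (p ^ 2 + q ^ 2) := by nlinarith [sq_nonneg (p - q)]
  have h4 : (p ^ 2 + q ^ 2) ^ 2 ≤ 2 * (p ^ 4 + q ^ 4) := by nlinarith [sq_nonneg (p ^ 2 - q ^ 2)]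
  have h5 : ‖a + δ • w‖ ^ 4 ≤ 8 * (p ^ 4 + q ^ 4) := by
    calc ‖a + δ • w‖ ^ 4 = (‖a + δ • w‖ ^ 2) ^ 2 := by ring
      _ ≤ ((p + q) ^ 2) ^ 2 := pow_le_pow_left₀ (by positivity) h2 2
      _ ≤ (2 * (p ^ 2 + q ^ 2)) ^ 2 := pow_le_pow_left₀ (by positivity) h3 2
      _ = 4 * (p ^ 2 + q ^ 2) ^ 2 := by ring
      _ ≤ 8 * (p ^ 4 + q ^ 4) := by nlinarith
  have h6 : (1 + ‖a + δ • w‖ ^ 2) ^ 2 ≤ 2 + 2 * ‖a + δ • w‖ ^ 4 := by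
    nlinarith [sq_nonneg (‖a + δ • w‖ ^ 2 - 1)]
  have hq4 : q ^ 4 = δ ^ 4 * ‖w‖ ^ 4 := by simp only [q]; ring
  nlinarith

/-- **Quartic moment bound**: `∫ φ_δ(v − a)(1 + |v|²)² dv ≤ c₄(δ)(1 + |a|⁴)`. [folklore] -/
theorem integral_phi_env_le {δ : ℝ} (hδ : 0 < δ) (a : V3) :
    ∫ v, phi δ (v - a) * (1 + ‖v‖ ^ 2) ^ 2 ≤ c4 δ * (1 + ‖a‖ ^ 4) := by
  rw [integral_phi_sub_mul hδ]
  have hint : Integrable (fun w : V3 => 2 + 16 * ‖a‖ ^ 4 + 16 * δ ^ 4 * ‖w‖ ^ 4) (stdGaussian V3) :=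
    (integrable_const _).add (integrable_norm_pow_four_stdGaussian.const_mul _)
  have h1 : ∫ w, (1 + ‖a + δ • w‖ ^ 2) ^ 2 ∂stdGaussian V3 ≤
      ∫ w, (2 + 16 * ‖a‖ ^ 4 + 16 * δ ^ 4 * ‖w‖ ^ 4) ∂stdGaussian V3 := by
    refine integral_mono_of_nonneg (Eventually.of_forall fun w => by positivity) hint
      (Eventually.of_forall fun w => env_add_smul_le hδ.le a w)
  have h2 : ∫ w, (2 + 16 * ‖a‖ ^ 4 + 16 * δ ^ 4 * ‖w‖ ^ 4) ∂stdGaussian V3 =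
      2 + 16 * ‖a‖ ^ 4 + 16 * δ ^ 4 * M4g := by
    rw [integral_add (integrable_const _) (integrable_norm_pow_four_stdGaussian.const_mul _), integral_const,
      integral_const_mul]
    simp [M4g]
  have h3 : 2 + 16 * ‖a‖ ^ 4 + 16 * δ ^ 4 * M4g ≤ c4 δ * (1 + ‖a‖ ^ 4) := by
    have hM := M4g_nonneg
    have ha : 0 ≤ ‖a‖ ^ 4 := by positivity
    have hd : 0 ≤ δ ^ 4 := by positivity
    unfold c4
    nlinarith [mul_nonneg (mul_nonneg hd hM) ha]
  linarith

/-- **Linear bound for the entropic weight**: `∫ φ_δ(v − a) A(v) dv ≤ |K| + |log M| + 2 + 4|a| + 8δ`.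
[folklore] -/
theorem integral_phi_Aw_le {δ : ℝ} (hδ : 0 < δ) (K M : ℝ) (a : V3) :
    ∫ v, phi δ (v - a) * Aw K M v ≤ |K| + |Real.log M| + 2 + 4 * ‖a‖ + 8 * δ := by
  rw [integral_phi_sub_mul hδ]
  have hn : Integrable (fun w : V3 => ‖w‖) (stdGaussian V3) := IsGaussian.integrable_id.norm
  have hint : Integrable (fun w : V3 => |K| + |Real.log M| + 2 + 4 * ‖a‖ + 4 * δ * ‖w‖) (stdGaussian V3) :=
    (integrable_const _).add (hn.const_mul _)
  have hpt : ∀ w : V3, Aw K M (a + δ • w) ≤ |K| + |Real.log M| + 2 + 4 * ‖a‖ + 4 * δ * ‖w‖ := fun w => by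
    have h1 := Aw_le K M (a + δ • w)
    have h2 : ‖a + δ • w‖ ≤ ‖a‖ + δ * ‖w‖ := by
      calc ‖a + δ • w‖ ≤ ‖a‖ + ‖δ • w‖ := norm_add_le _ _
        _ = ‖a‖ + δ * ‖w‖ := by rw [norm_smul, Real.norm_eq_abs, abs_of_pos hδ]
    linarith
  have h1 : ∫ w, Aw K M (a + δ • w) ∂stdGaussian V3 ≤
      ∫ w, (|K| + |Real.log M| + 2 + 4 * ‖a‖ + 4 * δ * ‖w‖) ∂stdGaussian V3 :=
    integral_mono_of_nonneg (Eventually.of_forall fun w => (zero_le_two.trans (two_le_Aw K M _))) hint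
      (Eventually.of_forall hpt)
  have h2 : ∫ w, (|K| + |Real.log M| + 2 + 4 * ‖a‖ + 4 * δ * ‖w‖) ∂stdGaussian V3 ≤
      |K| + |Real.log M| + 2 + 4 * ‖a‖ + 8 * δ := by
    rw [integral_add (integrable_const _) (hn.const_mul _), integral_const, integral_const_mul]
    simp only [probReal_univ, one_smul]
    have h := EquilibriumForecastLine.integral_norm_stdGaussian_le_two
    have hd : 0 ≤ 4 * δ := by positivity
    nlinarith [mul_le_mul_of_nonneg_left h hd]
  linarith

/-- **Envelope bound for a general mark**: if `|F| ≤ C(1 + |v|²)²` then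
`|∫ φ_δ(v − a) F(v) dv| ≤ C c₄(δ)(1 + |a|⁴)`. [folklore] -/
theorem abs_integral_phi_sub_mul_le {δ : ℝ} (hδ : 0 < δ) {F : V3 → ℝ} {C : ℝ}
    (hle : ∀ v, |F v| ≤ C * (1 + ‖v‖ ^ 2) ^ 2) (a : V3) :
    |∫ v, phi δ (v - a) * F v| ≤ C * (c4 δ * (1 + ‖a‖ ^ 4)) := by
  have hC : 0 ≤ C := by
    have h := (abs_nonneg _).trans (hle 0)
    have h1 : (0 : ℝ) < (1 + ‖(0 : V3)‖ ^ 2) ^ 2 := by positivity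
    nlinarith
  have henv : Integrable (fun v => phi δ (v - a) * (C * (1 + ‖v‖ ^ 2) ^ 2)) :=
    integrable_phi_sub_mul hδ (by fun_prop) (C := C)
      (fun v => by rw [abs_of_nonneg (by positivity)]) a
  calc |∫ v, phi δ (v - a) * F v| ≤ ∫ v, |phi δ (v - a) * F v| := abs_integral_le_integral_abs
    _ ≤ ∫ v, phi δ (v - a) * (C * (1 + ‖v‖ ^ 2) ^ 2) := by
        refine integral_mono_of_nonneg (Eventually.of_forall fun v => abs_nonneg _) henv
          (Eventually.of_forall fun v => ?_)
        dsimp only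
        rw [abs_mul, abs_of_nonneg (phi_nonneg hδ _)]
        exact mul_le_mul_of_nonneg_left (hle v) (phi_nonneg hδ _)
    _ = C * ∫ v, phi δ (v - a) * (1 + ‖v‖ ^ 2) ^ 2 := by
        rw [← integral_const_mul]
        refine integral_congr_ae (Eventually.of_forall fun v => ?_)
        dsimp only
        ring
    _ ≤ C * (c4 δ * (1 + ‖a‖ ^ 4)) := mul_le_mul_of_nonneg_left (integral_phi_env_le hδ a) hC

/-- REGISTERED SUB-GOAL `stub_windowedEntropyBalanceB` of the line `empirical-h-theorem` (crux
stmt-AtomisticToContinuum-15141): every translate of the velocity mollifier `M_{1,δ²,0}(· − a)` has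
unit mass (restating `integral_phi_sub`). [folklore] -/
theorem stub_windowedEntropyBalanceB :
    ∀ δ : ℝ, 0 < δ → ∀ a : V3, ∫ v, localMaxwellian 1 (δ ^ 2) (0 : V3) (v - a) = 1 :=
  fun _ hδ a => integral_phi_sub hδ a

end Summit.AtomisticToContinuum.HydrodynamicLimit.Theorems.ChaosClosesEulerEntropyBalance

end
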